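import Mathlib
import Summits.QuantumFields.YangMills.Theorems.BalabanUVNodesN15BackgroundPairSpace
import Summits.QuantumFields.YangMills.Theorems.BalabanUVNodesN15BackgroundLayerEntries
import HarnessLib

/-!
# Route «BalabanUVNodes» (cluster K4 «SpineRates»), Track-A DAG node N15 = spine estimate NE2, BACKGROUND LAYER — `T4EtaRate.NE2PlusOperator` BY NAME FOR
# THE FIRST-ORDER PERTURBATION SPECIES: the carrier of coefficient FAMILIES `(c′, a′_μ)` with the (3.35) letter pair on each, the realised instances with
# the datum's `M`, the per-index `EtaRateIneq342` with explicit constants (entries 0∕1 = the components of B1b's constructed first-order pair), the readout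

Cell `pub-ymgap`, seat `pub-ymgap-dag-n15-b` (generation g5; FIRST-MISSING-ESTIMATE, HUMAN RULING D-0062; chair R424 venue; ROSTER-D0062 l.26).
`bears_on: R4∕N15`.  Filed `--supports stmt-QuantumFields-19351` (helper).  Imports parts B1b (`bgPair`, `hasMaj_idef_bgPair_proj`, `projO`), A3 (`poly0_le`),
A2 (`fineGeo`, `blockAvg_zero`, `one_le_pref4`, `bgConst`) `…N15.BackgroundLayer` and g0's `…N15.OperatorReadout` BY NAME; nothing in the tree is modified.

THE POINT (ref-B READ-348 note: *«first missing estimate UNCHANGED = first-order species … and G(U) with U live»*).  Parts A2∕A4 read out the ZEROTH-order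
species `V = M_c`.  Here the background carrier holds the print's FIRST-order data: a configuration is a family `U = (c′, (a′_μ)_{μ ∈ J})` of fine coefficient
fields (the species of (3.52) p. 400: `a′_μ ↔ A′(b)` in `Σ_b i[A′(b), (D^η_Uλ)(b)]`, `c′ ↔ D^{η*}_U A` in `i[(D^{η*}_U A)(x), λ(x)]`), `Reg335 c α₀ U` = THE (3.35)
LETTER PAIR ON EACH (sup `≤ c·M·α₀`, within-block oscillation `≤ c·M·α₀·θ`), the transport is the block average of each, and the kernel family's entries 0
and 1 are the `none` ∕ `some ν` components of the η-difference of B1b's CONSTRUCTED first-order pair `bgPair` — `𝔇(X′(U), X(Ū))` and `𝔇(∇′_νX′(U), ∇_νX(Ū))` —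
entries 2∕3 the consumer's (displayed, as A2; their construction for the first-order pair = the source step ∕ Δ-derived object over the stacked space, census).

CONTENTS ([folklore] plumbing + bookkeeping; 5 defs).
* §1 `coeffBg₁ π J M θ : B9.Backgrounds` (`Cfg := (X′ → ℝ) × (J → X′ → ℝ)`), `reg335_coeffBg₁_iff`, `avg₁` ∕ `avg₁_zero`, `bgPairing₁`, `bgInstance₁`, `bgInstance₁_M`
  (the guard reads the datum's `M`).
* §2 `bgOps₁` (entries 0∕1 CONSTRUCTED from `bgPair`, entries 2∕3 the consumer's `T`), `bgFamily₁`; **`hasMaj_entry01_background₁`** (per index, per regular `U`,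
  `j ∈ {none, some ν}`: `≤ bgConst(β, c_r, m₀, c₃₅(1 + |J|), a₀)·θ·e^{−(δ−σ)d}` under the guard `M ≥ 1`, `α₀ > 0`, `M·α₀ ≤ a₀`, `β(c₃₅(1+|J|)a₀)c_r ≤ ½` — B1b's
  `hasMaj_idef_bgPair_proj` with the letters READ OFF `Reg335` and A3's `poly0_le`).
* §3 **`etaRateIneq342_background₁`** (PER INDEX, explicit `B₀ = max(bgConst(…), B₃)`, `δ₀ = min(δ − σ, ρ₃)`) and **`ne2PlusOperator_background₁`**
  (`T4EtaRate.NE2PlusOperator c₃₅ (bgInstance₁ …) (bgFamily₁ …)` for ANY family with uniform letters; `M₅ := 1`, `a₀ := (2c₃₅(1+|J|)(βc_r+1))⁻¹`; (3.35) CONSUMED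
  on every coefficient of the first-order species).

HONEST FRAMING ∕ LIMITS.  Bookkeeping over hypothesis-shaped data: the `U ≡ 1` layer (pieces `G, G′`, derived pieces `D_μ, D′_μ`, their η-defects with the rate
number `θ`, entries 2∕3 operators) DISPLAYED; scalar coefficients (matrix species: parts 13–19's product carrier, not wired); linearised transport; sites of
physical size `≥ 1`; the by-name §3 statement is LIVE iff the consumer's family has unbounded `M` (per-index §3 is the unconditional content); nothing about
Bałaban's `G(U)` of [B6]∕[B9] asserted — in particular `U` enters through its (3.35) gauge-field letters only («G(U) with U live» in the covariant sense is NOT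
reached).  NE2⁺ NOT PRINTED, NOT proved; count-neutral (typed 28∕28; nothing discharged); N15 NOT discharged; one finite lattice at fixed ε — NOT infinite
volume, NOT OS on ℝ⁴, NOT a mass gap, NOT Clay.
-/

noncomputable section

namespace Summit.QuantumFields.YangMills.BalabanUVNodes.N15.BackgroundLayer

open Literature.MathematicalPhysics.QuantumFieldTheory.Balaban1983to89
open Literature.MathematicalPhysics.QuantumFieldTheory.Balaban1983to89.B11SectG (BlockNorm HasMaj RowSum)
open Literature.MathematicalPhysics.QuantumFieldTheory.Balaban1983to89.T4EtaRate (PairedInstance EtaPairing EtaRateIneq342 NE2PlusOperator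
  rateFactor)
open Literature.MathematicalPhysics.QuantumFieldTheory.Balaban1983to89.T4EtaRateDefect (idef rateWeight)
open Literature.MathematicalPhysics.QuantumFieldTheory.Balaban1983to89.T4EtaRateCoeffDefect (pull pull_apply FibreOsc blockAvg fit_blockAvg)
open Literature.MathematicalPhysics.QuantumFieldTheory.Balaban1983to89.B6RandomWalk (Triangle254)
open Literature.MathematicalPhysics.QuantumFieldTheory.Balaban1983to89.B9SectDSup (inv_one_sub_le_two)
open Summit.QuantumFields.YangMills.BalabanUVNodes.N15.OperatorReadout (opGeo opFamily opGeo_len rateFactor_opGeo etaRateIneq342_of_hasMaj)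

/-! ## §1 The first-order coefficient carrier, the pairing, the instances -/

section Carrier

variable {X X' : Type} (J : Type)

/-- THE FIRST-ORDER COEFFICIENT BACKGROUND CARRIER: configurations are FAMILIES `U = (c′, (a′_μ)_μ)` of fine coefficient fields (the species of (3.52):
`V′ = M_{c′} + Σ_μ M_{a′_μ}∘∇′_μ`), `one := 0`, `mul := (+)`, and `Reg335 c α₀ U` = THE (3.35) LETTER PAIR ON EVERY COEFFICIENT: sup letters `|c′|, |a′_μ| ≤ c·M·α₀` and
within-block oscillation letters `FibreOsc π · (c·M·α₀·θ)`; `Reg336` repeats it; (3.37)–(3.38) inert. [cite: Balaban1985BackgroundPropagators, (3.35) p.396 (shape); (3.52) p.400 (first-order perturbation: shape)] -/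
def coeffBg₁ (π : X' → X) (M θ : ℝ) : B9.Backgrounds where
  Cfg := (X' → ℝ) × (J → X' → ℝ)
  one := 0
  mul := fun U₁ U₂ => U₁ + U₂
  Reg335 := fun c α₀ U => ((∀ x', |U.1 x'| ≤ c * M * α₀) ∧ ∀ μ x', |U.2 μ x'| ≤ c * M * α₀) ∧
    (FibreOsc π U.1 (fun _ => c * M * α₀ * θ) ∧ ∀ μ, FibreOsc π (U.2 μ) (fun _ => c * M * α₀ * θ))
  Reg336 := fun c α₀ U => ((∀ x', |U.1 x'| ≤ c * M * α₀) ∧ ∀ μ x', |U.2 μ x'| ≤ c * M * α₀) ∧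
    (FibreOsc π U.1 (fun _ => c * M * α₀ * θ) ∧ ∀ μ, FibreOsc π (U.2 μ) (fun _ => c * M * α₀ * θ))
  Cplx337 := fun _ _ _ => True
  Cplx338 := fun _ _ _ => True

/-- Unfolding of the carrier's (3.35). [folklore] -/
theorem reg335_coeffBg₁_iff (π : X' → X) (M θ c α₀ : ℝ) (U : (X' → ℝ) × (J → X' → ℝ)) :
    (coeffBg₁ J π M θ).Reg335 c α₀ U ↔ ((∀ x', |U.1 x'| ≤ c * M * α₀) ∧ ∀ μ x', |U.2 μ x'| ≤ c * M * α₀) ∧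
      (FibreOsc π U.1 (fun _ => c * M * α₀ * θ) ∧ ∀ μ, FibreOsc π (U.2 μ) (fun _ => c * M * α₀ * θ)) := Iff.rfl

variable [Fintype X'] [DecidableEq X]

/-- THE TRANSPORT of a coefficient family: block average of every coefficient (linearised (C3)). [folklore] -/
def avg₁ (π : X' → X) (U : (X' → ℝ) × (J → X' → ℝ)) : (X → ℝ) × (J → X → ℝ) := (blockAvg π U.1, fun μ => blockAvg π (U.2 μ))

/-- `avg_one`: the transport of the trivial family is trivial. [folklore] -/
theorem avg₁_zero (π : X' → X) : avg₁ J π (0 : (X' → ℝ) × (J → X' → ℝ)) = 0 :=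
  Prod.ext (blockAvg_zero π) (funext fun _ => blockAvg_zero π)

variable {g : B6.Geometry} [Fintype X]

/-- THE η-PAIRING over the first-order coefficient carriers (NOT PRINTED data): scale shift `n`, identity on sites, pull-back of test functions, block-averaged
coefficient families. [cite: King1986, p.664 (convention before Prop. 3.8)] -/
def bgPairing₁ (blk : X → g.Site) (π : X' → X) (n : ℕ) (hL : g.L ≠ 0) (θc θ : ℝ) :
    EtaPairing (opGeo g X blk) (fineGeo g X' (blk ∘ π) n) (coeffBg₁ J (fun x : X => x) g.M θc) (coeffBg₁ J π g.M θ) where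
  n := n
  k_eq := rfl
  L_eq := rfl
  M_eq := rfl
  eta_eq := by
    show g.eta * (g.L ^ n)⁻¹ * g.L ^ n = g.eta
    rw [mul_assoc, inv_mul_cancel₀ (pow_ne_zero _ hL), mul_one]
  ι := fun y => y
  scale_ι := fun _ => rfl
  dist_ι := fun _ _ => rfl
  τ := fun lam => pull π lam
  suppIn_τ := fun _ _ h x' hx' => h (π x') hx'
  supNorm_τ := fun lam => by
    show (⨆ x' : X', |lam (π x')|) ≤ ⨆ x : X, |lam x|
    exact Real.iSup_le (fun x' => abs_le_iSup_abs lam (π x')) (Real.iSup_nonneg fun x => abs_nonneg _)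
  avg := avg₁ J π
  avg_one := avg₁_zero J π

/-- THE REALISED PAIRED INSTANCE of the first-order background layer. [cite: Balaban1985BackgroundPropagators, Thm 3.14 pp.426–427 (typing template)] -/
def bgInstance₁ (blk : X → g.Site) (π : X' → X) (n : ℕ) (hL : g.L ≠ 0) (θc θ : ℝ) : PairedInstance :=
  ⟨opGeo g X blk, fineGeo g X' (blk ∘ π) n, coeffBg₁ J (fun x : X => x) g.M θc, coeffBg₁ J π g.M θ, bgPairing₁ J blk π n hL θc θ⟩

/-- THE GUARD IS LIVE: the fine geometry's [B9] size parameter is the datum's `M`. [folklore] -/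
theorem bgInstance₁_M (blk : X → g.Site) (π : X' → X) (n : ℕ) (hL : g.L ≠ 0) (θc θ : ℝ) : (bgInstance₁ J blk π n hL θc θ).gf.M = g.M := rfl

end Carrier

/-! ## §2 The entry operators (0∕1 constructed) and their majorants under the guard -/

section Entries

variable {X X' J : Type} [Fintype X] [Fintype X'] [Fintype J] [DecidableEq X] [DecidableEq X'] [DecidableEq J] {g : B6.Geometry}
  (blk : X → g.Site) (π : X' → X)

/-- THE FOUR ENTRY OPERATORS at a coefficient family `U`: ENTRY 0 = `𝔇(X′(U), X(Ū))` and ENTRY 1 = `𝔇(∇′_νX′(U), ∇_νX(Ū))`, the `none` ∕ `some ν` components of the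
η-difference of B1b's constructed first-order pair (`Ū` = the block-averaged family); ENTRIES 2∕3 the consumer's. [cite: Balaban1985BackgroundPropagators, (3.42) p.397 (the four entries: shape)] -/
def bgOps₁ (ν : J) (G : (X → ℝ) →ₗ[ℝ] (X → ℝ)) (D : J → (X → ℝ) →ₗ[ℝ] (X → ℝ)) (G' : (X' → ℝ) →ₗ[ℝ] (X' → ℝ)) (D' : J → (X' → ℝ) →ₗ[ℝ] (X' → ℝ))
    (T : Fin 2 → (X' → ℝ) × (J → X' → ℝ) → ((X → ℝ) →ₗ[ℝ] (X' → ℝ))) :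
    Fin 4 → (X' → ℝ) × (J → X' → ℝ) → ((X → ℝ) →ₗ[ℝ] (X' → ℝ)) :=
  fun n U => ![idef (pull π) (pull π) (projO none ∘ₗ bgPair G' D' U.1 U.2) (projO none ∘ₗ bgPair G D (avg₁ J π U).1 (avg₁ J π U).2),
    idef (pull π) (pull π) (projO (some ν) ∘ₗ bgPair G' D' U.1 U.2) (projO (some ν) ∘ₗ bgPair G D (avg₁ J π U).1 (avg₁ J π U).2),
    T 0 U, T 1 U] n

/-- THE KERNEL FAMILY over the first-order carrier (g0 `opFamily`). [cite: Balaban1985BackgroundPropagators, (3.42) p.397 (the four sup entries: shape)] -/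
def bgFamily₁ (n : ℕ) (hL : g.L ≠ 0) (θc θ : ℝ) (ν : J) (G : (X → ℝ) →ₗ[ℝ] (X → ℝ)) (D : J → (X → ℝ) →ₗ[ℝ] (X → ℝ))
    (G' : (X' → ℝ) →ₗ[ℝ] (X' → ℝ)) (D' : J → (X' → ℝ) →ₗ[ℝ] (X' → ℝ)) (T : Fin 2 → (X' → ℝ) × (J → X' → ℝ) → ((X → ℝ) →ₗ[ℝ] (X' → ℝ))) :
    B9.KernelFamily (bgInstance₁ J blk π n hL θc θ).gc (bgInstance₁ J blk π n hL θc θ).Bf :=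
  show B9.KernelFamily (opGeo g X blk) (coeffBg₁ J π g.M θ) from
    opFamily (g := g) (B := coeffBg₁ J π g.M θ) blk (blk ∘ π) (bgOps₁ π ν G D G' D' T)

variable {G : (X → ℝ) →ₗ[ℝ] (X → ℝ)} {D : J → (X → ℝ) →ₗ[ℝ] (X → ℝ)} {G' : (X' → ℝ) →ₗ[ℝ] (X' → ℝ)} {D' : J → (X' → ℝ) →ₗ[ℝ] (X' → ℝ)}

/-- **ENTRIES 0∕1 UNDER THE GUARD, LETTERS READ OFF `Reg335`.**  `U ≡ 1` layer: pieces and derived pieces `≤ β·e^{−δd}` at both spacings, defects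
`𝔇(G′,G), 𝔇(D′_μ,D_μ) ≤ m₀·θ·e^{−δd}`, `σ ≤ δ`; guard: `c₃₅ > 0`, `a₀ ≥ 0`, `β·(c₃₅(1+|J|)·a₀)·c_r ≤ ½`, `M ≥ 1`, `α₀ > 0`, `M·α₀ ≤ a₀`; configuration `U` with
`(coeffBg₁ J π M θ).Reg335 c₃₅ α₀ U`.  Then for `j ∈ Option J` (entry 0: `none`; entry 1 in direction `ν`: `some ν`):
`𝔇(X̂′_j(U), X̂_j(Ū)) ≤ bgConst(β, c_r, m₀, c₃₅(1+|J|), a₀)·θ·e^{−(δ−σ)d}`. [cite: Balaban1985BackgroundPropagators, Thm 3.1 p.397 (quantifier template); (3.52) p.400, (3.63)–(3.65) pp.402–403 (shapes, mechanism)] -/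
theorem hasMaj_entry01_background₁ (htri : Triangle254 g) (hd : ∀ a b : g.Site, 0 ≤ g.dist a b) {σ cr : ℝ} (hσ : 0 ≤ σ) (hcr : 0 ≤ cr)
    (hrow : RowSum g σ cr) {δ β m₀ θ c35 a₀ M α₀ : ℝ} (hσδ : σ ≤ δ) (hβ : 0 ≤ β) (hm₀ : 0 ≤ m₀) (hθ : 0 ≤ θ) (hc35 : 0 < c35)
    (hq : β * (c35 * (1 + Fintype.card J) * a₀) * cr ≤ 1 / 2) (hM : 1 ≤ M) (hα₀ : 0 < α₀) (hMα : M * α₀ ≤ a₀)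
    (hG : HasMaj (BlockNorm.ofBlocks g blk) (BlockNorm.ofBlocks g blk) G (fun y y' => β * Real.exp (-(δ * g.dist y y'))))
    (hD : ∀ μ, HasMaj (BlockNorm.ofBlocks g blk) (BlockNorm.ofBlocks g blk) (D μ) (fun y y' => β * Real.exp (-(δ * g.dist y y'))))
    (hG' : HasMaj (BlockNorm.ofBlocks g (blk ∘ π)) (BlockNorm.ofBlocks g (blk ∘ π)) G' (fun y y' => β * Real.exp (-(δ * g.dist y y'))))
    (hD' : ∀ μ, HasMaj (BlockNorm.ofBlocks g (blk ∘ π)) (BlockNorm.ofBlocks g (blk ∘ π)) (D' μ) (fun y y' => β * Real.exp (-(δ * g.dist y y'))))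
    (hDG : HasMaj (BlockNorm.ofBlocks g blk) (BlockNorm.ofBlocks g (blk ∘ π)) (idef (pull π) (pull π) G' G)
      (fun y y' => m₀ * θ * Real.exp (-(δ * g.dist y y'))))
    (hDD : ∀ μ, HasMaj (BlockNorm.ofBlocks g blk) (BlockNorm.ofBlocks g (blk ∘ π)) (idef (pull π) (pull π) (D' μ) (D μ))
      (fun y y' => m₀ * θ * Real.exp (-(δ * g.dist y y'))))
    {U : (X' → ℝ) × (J → X' → ℝ)} (hreg : (coeffBg₁ J π M θ).Reg335 c35 α₀ U) (j : Option J) :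
    HasMaj (BlockNorm.ofBlocks g blk) (BlockNorm.ofBlocks g (blk ∘ π))
      (idef (pull π) (pull π) (projO j ∘ₗ bgPair G' D' U.1 U.2) (projO j ∘ₗ bgPair G D (avg₁ J π U).1 (avg₁ J π U).2))
      (fun y y' => bgConst β cr m₀ (c35 * (1 + Fintype.card J)) a₀ * θ * Real.exp (-((δ - σ) * g.dist y y'))) := by
  obtain ⟨⟨hsc, hsa⟩, hoc, hoa⟩ := (reg335_coeffBg₁_iff J π M θ c35 α₀ U).1 hreg
  -- the letters under the guard
  set r : ℝ := c35 * M * α₀ with hr_def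
  have hJ : (1 : ℝ) ≤ 1 + Fintype.card J := le_add_of_nonneg_right (Nat.cast_nonneg _)
  have hJ0 : (0 : ℝ) ≤ 1 + Fintype.card J := zero_le_one.trans hJ
  have hM0 : 0 ≤ M := zero_le_one.trans hM
  have hr0 : 0 ≤ r := by positivity
  have hra : r ≤ c35 * a₀ := by rw [hr_def, mul_assoc]; exact mul_le_mul_of_nonneg_left hMα hc35.le
  have hRa : r * (1 + Fintype.card J) ≤ c35 * (1 + Fintype.card J) * a₀ := by
    calc r * (1 + Fintype.card J) ≤ c35 * a₀ * (1 + Fintype.card J) := mul_le_mul_of_nonneg_right hra hJ0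
      _ = c35 * (1 + Fintype.card J) * a₀ := by ring
  have hR0 : 0 ≤ r * (1 + Fintype.card J) := mul_nonneg hr0 hJ0
  have hq' : β * (r * (1 + Fintype.card J)) * cr ≤ 1 / 2 :=
    (mul_le_mul_of_nonneg_right (mul_le_mul_of_nonneg_left hRa hβ) hcr).trans hq
  have hq1 : β * (r * (1 + Fintype.card J)) * cr < 1 := by linarith
  have hinv : (1 - β * (r * (1 + Fintype.card J)) * cr)⁻¹ ≤ 2 := inv_one_sub_le_two hq'
  have hinv0 : 0 ≤ (1 - β * (r * (1 + Fintype.card J)) * cr)⁻¹ := inv_nonneg.2 (by linarith)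
  -- coarse coefficients = block averages: sup letters kept, fits from the oscillation letters
  have hc : ∀ x, |(avg₁ J π U).1 x| ≤ r := abs_blockAvg_le π hr0 hsc
  have ha : ∀ μ x, |(avg₁ J π U).2 μ x| ≤ r := fun μ => abs_blockAvg_le π hr0 (hsa μ)
  have hfc : ∀ x', |U.1 x' - (avg₁ J π U).1 (π x')| ≤ r * θ := fun x' => fit_blockAvg π hoc x'
  have hfa : ∀ μ x', |U.2 μ x' - (avg₁ J π U).2 μ (π x')| ≤ r * θ := fun μ x' => fit_blockAvg π (hoa μ) x'
  have key := hasMaj_idef_bgPair_proj blk π htri hd hσ hcr hrow (ρ := δ - σ) (by linarith) (by linarith) hβ hr0 (mul_nonneg hr0 hθ)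
    (mul_nonneg hm₀ hθ) hG hD hG' hD' hDG hDD hc ha hsc hsa hfc hfa hq1 j
  refine key.mono fun a b => ?_
  simp only [one_mul]
  refine mul_le_mul_of_nonneg_right ?_ (Real.exp_nonneg _)
  -- the entry-0 polynomial with `r ↦ r(1+|J|)`, `o ↦ rθ(1+|J|)`: A3's `poly0_le` at `c₃₅ ↦ c₃₅(1+|J|)`
  have hpoly := poly0_le (β := β) (cr := cr) (m₀ := m₀) (θ := θ) (c35 := c35 * (1 + Fintype.card J)) (a₀ := a₀)
    (r := r * (1 + Fintype.card J)) (u := (1 - β * (r * (1 + Fintype.card J)) * cr)⁻¹) hβ hcr hm₀ hθ hR0 hRa hinv0 hinv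
  have heq : r * θ * (1 + Fintype.card J) = r * (1 + Fintype.card J) * θ := by ring
  rw [heq]
  exact hpoly

end Entries

/-! ## §3 Per index `EtaRateIneq342`, and the node's first conjunct BY NAME -/

section PerIndex

variable {X X' J : Type} [Fintype X] [Fintype X'] [Fintype J] [DecidableEq X] [DecidableEq X'] [DecidableEq J] {g : B6.Geometry}
  (blk : X → g.Site) (π : X' → X)

/-- **`EtaRateIneq342` PER INDEX, FIRST-ORDER SPECIES, EXPLICIT CONSTANTS.**  Data of `hasMaj_entry01_background₁` with `η, L > 0`, sites of physical size
`≥ 1`, rate number `θ ≤ (L^j)^{−γ}`, entries 2∕3 operators with majorants `B₃·θ·e^{−ρ₃d}` (`B₃ ≥ 0`): for every `Reg335`-regular family `U` under the guard,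
`EtaRateIneq342 (opFamily blk (blk∘π) (bgOps₁ …)) (max bgConst(…) B₃) (min (δ−σ) ρ₃) γ U`. [cite: Balaban1985BackgroundPropagators, Thm 3.1 (3.42) p.397 (shape)] -/
theorem etaRateIneq342_background₁ (htri : Triangle254 g) (hd : ∀ a b : g.Site, 0 ≤ g.dist a b) {σ cr : ℝ} (hσ : 0 ≤ σ) (hcr : 0 ≤ cr)
    (hrow : RowSum g σ cr) (hη : 0 < g.eta) (hL : 0 < g.L) (hlen : ∀ y, 1 ≤ g.len y) {δ β m₀ θ c35 a₀ M α₀ γ B₃ ρ₃ : ℝ}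
    (hσδ : σ ≤ δ) (hβ : 0 ≤ β) (hm₀ : 0 ≤ m₀) (hθ : 0 ≤ θ) (hθγ : ∀ y, θ ≤ rateWeight g γ y) (hc35 : 0 < c35) (ha₀ : 0 ≤ a₀)
    (hq : β * (c35 * (1 + Fintype.card J) * a₀) * cr ≤ 1 / 2) (hM : 1 ≤ M) (hα₀ : 0 < α₀) (hMα : M * α₀ ≤ a₀) (hB₃ : 0 ≤ B₃)
    {ν : J} {G : (X → ℝ) →ₗ[ℝ] (X → ℝ)} {D : J → (X → ℝ) →ₗ[ℝ] (X → ℝ)} {G' : (X' → ℝ) →ₗ[ℝ] (X' → ℝ)} {D' : J → (X' → ℝ) →ₗ[ℝ] (X' → ℝ)}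
    {T : Fin 2 → (X' → ℝ) × (J → X' → ℝ) → ((X → ℝ) →ₗ[ℝ] (X' → ℝ))}
    (hG : HasMaj (BlockNorm.ofBlocks g blk) (BlockNorm.ofBlocks g blk) G (fun y y' => β * Real.exp (-(δ * g.dist y y'))))
    (hD : ∀ μ, HasMaj (BlockNorm.ofBlocks g blk) (BlockNorm.ofBlocks g blk) (D μ) (fun y y' => β * Real.exp (-(δ * g.dist y y'))))
    (hG' : HasMaj (BlockNorm.ofBlocks g (blk ∘ π)) (BlockNorm.ofBlocks g (blk ∘ π)) G' (fun y y' => β * Real.exp (-(δ * g.dist y y'))))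
    (hD' : ∀ μ, HasMaj (BlockNorm.ofBlocks g (blk ∘ π)) (BlockNorm.ofBlocks g (blk ∘ π)) (D' μ) (fun y y' => β * Real.exp (-(δ * g.dist y y'))))
    (hDG : HasMaj (BlockNorm.ofBlocks g blk) (BlockNorm.ofBlocks g (blk ∘ π)) (idef (pull π) (pull π) G' G)
      (fun y y' => m₀ * θ * Real.exp (-(δ * g.dist y y'))))
    (hDD : ∀ μ, HasMaj (BlockNorm.ofBlocks g blk) (BlockNorm.ofBlocks g (blk ∘ π)) (idef (pull π) (pull π) (D' μ) (D μ))
      (fun y y' => m₀ * θ * Real.exp (-(δ * g.dist y y'))))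
    {U : (X' → ℝ) × (J → X' → ℝ)} (hreg : (coeffBg₁ J π M θ).Reg335 c35 α₀ U)
    (hT : ∀ n : Fin 2, HasMaj (BlockNorm.ofBlocks g blk) (BlockNorm.ofBlocks g (blk ∘ π)) (T n U)
      (fun y y' => B₃ * θ * Real.exp (-(ρ₃ * g.dist y y')))) :
    EtaRateIneq342 (opFamily (g := g) (B := coeffBg₁ J π M θ) blk (blk ∘ π) (bgOps₁ π ν G D G' D' T))
      (max (bgConst β cr m₀ (c35 * (1 + Fintype.card J)) a₀) B₃) (min (δ - σ) ρ₃) γ U := by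
  have hJ0 : (0 : ℝ) ≤ 1 + Fintype.card J := by positivity
  have h01 := hasMaj_entry01_background₁ blk π htri hd hσ hcr hrow hσδ hβ hm₀ hθ hc35 hq hM hα₀ hMα hG hD hG' hD' hDG hDD hreg
  have hC0 : 0 ≤ bgConst β cr m₀ (c35 * (1 + Fintype.card J)) a₀ := bgConst_nonneg hβ hcr hm₀ (mul_nonneg hc35.le hJ0) ha₀
  have hB₀ : 0 ≤ max (bgConst β cr m₀ (c35 * (1 + Fintype.card J)) a₀) B₃ := hC0.trans (le_max_left _ _)
  refine etaRateIneq342_of_hasMaj (g := g) (B := coeffBg₁ J π M θ) blk (blk ∘ π) hη.le hL.le hB₀ (bgOps₁ π ν G D G' D' T) U fun n => ?_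
  have hdom : ∀ {B ρ : ℝ}, 0 ≤ B → B ≤ max (bgConst β cr m₀ (c35 * (1 + Fintype.card J)) a₀) B₃ → min (δ - σ) ρ₃ ≤ ρ → ∀ y y' : g.Site,
      B * θ * Real.exp (-(ρ * g.dist y y')) ≤
        max (bgConst β cr m₀ (c35 * (1 + Fintype.card J)) a₀) B₃ * B9.pref4 ((opGeo g X blk).len y) n *
          Real.exp (-(min (δ - σ) ρ₃ * g.dist y y')) * max (rateFactor (opGeo g X blk) γ y) (rateFactor (opGeo g X blk) γ y') := by
    intro B ρ hB0 hB hρ y y'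
    have hpref : 1 ≤ B9.pref4 ((opGeo g X blk).len y) n := by rw [opGeo_len]; exact one_le_pref4 (hlen y) n
    have hexp : Real.exp (-(ρ * g.dist y y')) ≤ Real.exp (-(min (δ - σ) ρ₃ * g.dist y y')) :=
      Real.exp_le_exp.mpr (neg_le_neg (mul_le_mul_of_nonneg_right hρ (hd y y')))
    have hrf : θ ≤ max (rateFactor (opGeo g X blk) γ y) (rateFactor (opGeo g X blk) γ y') := by
      rw [rateFactor_opGeo g X blk hη.ne' hL γ y']
      exact (hθγ y').trans (le_max_right _ _)
    have hE : 0 ≤ Real.exp (-(min (δ - σ) ρ₃ * g.dist y y')) := Real.exp_nonneg _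
    calc B * θ * Real.exp (-(ρ * g.dist y y'))
        ≤ (max (bgConst β cr m₀ (c35 * (1 + Fintype.card J)) a₀) B₃ * B9.pref4 ((opGeo g X blk).len y) n) * θ *
            Real.exp (-(min (δ - σ) ρ₃ * g.dist y y')) := by
          refine mul_le_mul (mul_le_mul_of_nonneg_right ?_ hθ) hexp (Real.exp_nonneg _) (mul_nonneg (mul_nonneg hB₀ (zero_le_one.trans hpref)) hθ)
          calc B = B * 1 := (mul_one B).symm
            _ ≤ max (bgConst β cr m₀ (c35 * (1 + Fintype.card J)) a₀) B₃ * B9.pref4 ((opGeo g X blk).len y) n :=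
                mul_le_mul hB hpref zero_le_one hB₀
      _ = max (bgConst β cr m₀ (c35 * (1 + Fintype.card J)) a₀) B₃ * B9.pref4 ((opGeo g X blk).len y) n *
            Real.exp (-(min (δ - σ) ρ₃ * g.dist y y')) * θ := by ring
      _ ≤ _ := mul_le_mul_of_nonneg_left hrf (mul_nonneg (mul_nonneg hB₀ (zero_le_one.trans hpref)) hE)
  fin_cases n
  · exact (h01 none).mono (hdom hC0 (le_max_left _ _) (min_le_left _ _))
  · exact (h01 (some ν)).mono (hdom hC0 (le_max_left _ _) (min_le_left _ _))
  · exact (hT 0).mono (hdom hB₃ (le_max_right _ _) (min_le_right _ _))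
  · exact (hT 1).mono (hdom hB₃ (le_max_right _ _) (min_le_right _ _))

end PerIndex

section Node

variable {I J : Type} [Fintype J] [DecidableEq J] (g : I → B6.Geometry) (X X' : I → Type) [∀ i, Fintype (X i)] [∀ i, Fintype (X' i)]
  [∀ i, DecidableEq (X i)] [∀ i, DecidableEq (X' i)] (blk : ∀ i, X i → (g i).Site) (π : ∀ i, X' i → X i) (nsh : I → ℕ) (hL0 : ∀ i, (g i).L ≠ 0)
  (θc θ : I → ℝ) (ν : I → J) (G : ∀ i, (X i → ℝ) →ₗ[ℝ] (X i → ℝ)) (D : ∀ i, J → (X i → ℝ) →ₗ[ℝ] (X i → ℝ))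
  (G' : ∀ i, (X' i → ℝ) →ₗ[ℝ] (X' i → ℝ)) (D' : ∀ i, J → (X' i → ℝ) →ₗ[ℝ] (X' i → ℝ))
  (T : ∀ i, Fin 2 → (X' i → ℝ) × (J → X' i → ℝ) → ((X i → ℝ) →ₗ[ℝ] (X' i → ℝ)))

/-- **NE2⁺, OPERATOR LAYER — `T4EtaRate.NE2PlusOperator` BY NAME FOR THE FIRST-ORDER SPECIES, BACKGROUND BLOCK LIVE.**  For ANY family — [B6] carriers
((2.54), `d ≥ 0`, uniform (2.61) `(σ, c_r)`, `η, L > 0`, sites of size `≥ 1`), lattices blocked and paired, a fixed direction set `J`; the `U ≡ 1` LAYER with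
UNIFORM letters: pieces `G_i, G′_i` and derived pieces `D_{i,μ}, D′_{i,μ}` `≤ β·e^{−δd}` (`σ < δ`), defects `𝔇(G′_i,G_i), 𝔇(D′_{i,μ},D_{i,μ}) ≤ m₀·θ_i·e^{−δd}`,
`0 ≤ θ_i ≤ (L^j)^{−γ}` (`γ > 0`); entries 2∕3 with uniform majorants `B₃θ_i e^{−ρ₃d}` (`ρ₃ > 0`); `c₃₅ > 0` —: the realised instances over the first-order
carriers (guard = the datum's `M`) with the kernel families `bgFamily₁` (entries 0∕1 = the components of the CONSTRUCTED first-order pair) satisfy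
`NE2PlusOperator c₃₅`, with `M₅ = 1`, `a₀ = (2c₃₅(1+|J|)(βc_r+1))⁻¹`, `B₀ = max(bgConst(…), B₃) + 1`, `δ₀ = min(δ−σ, ρ₃)`; (3.35) CONSUMED on every coefficient.
[cite: Balaban1985BackgroundPropagators, Thm 3.1 p.397 (quantifier template); (3.35) p.396, (3.52) p.400, (3.63)–(3.65) pp.402–403 (shapes, mechanism)] -/
theorem ne2PlusOperator_background₁ (c35 : ℝ) (hc35 : 0 < c35)
    (htri : ∀ i, Triangle254 (g i)) (hd : ∀ i (a b : (g i).Site), 0 ≤ (g i).dist a b) {σ cr : ℝ} (hσ : 0 ≤ σ) (hcr : 0 ≤ cr)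
    (hrow : ∀ i, RowSum (g i) σ cr) (hη : ∀ i, 0 < (g i).eta) (hL : ∀ i, 0 < (g i).L) (hlen : ∀ i y, 1 ≤ (g i).len y)
    {δ β m₀ γ B₃ ρ₃ : ℝ} (hσδ : σ < δ) (hβ : 0 ≤ β) (hm₀ : 0 ≤ m₀) (hγ : 0 < γ) (hθ : ∀ i, 0 ≤ θ i) (hθγ : ∀ i y, θ i ≤ rateWeight (g i) γ y)
    (hB₃ : 0 ≤ B₃) (hρ₃ : 0 < ρ₃)
    (hG : ∀ i, HasMaj (BlockNorm.ofBlocks (g i) (blk i)) (BlockNorm.ofBlocks (g i) (blk i)) (G i) (fun y y' => β * Real.exp (-(δ * (g i).dist y y'))))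
    (hD : ∀ i μ, HasMaj (BlockNorm.ofBlocks (g i) (blk i)) (BlockNorm.ofBlocks (g i) (blk i)) (D i μ)
      (fun y y' => β * Real.exp (-(δ * (g i).dist y y'))))
    (hG' : ∀ i, HasMaj (BlockNorm.ofBlocks (g i) (blk i ∘ π i)) (BlockNorm.ofBlocks (g i) (blk i ∘ π i)) (G' i)
      (fun y y' => β * Real.exp (-(δ * (g i).dist y y'))))
    (hD' : ∀ i μ, HasMaj (BlockNorm.ofBlocks (g i) (blk i ∘ π i)) (BlockNorm.ofBlocks (g i) (blk i ∘ π i)) (D' i μ)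
      (fun y y' => β * Real.exp (-(δ * (g i).dist y y'))))
    (hDG : ∀ i, HasMaj (BlockNorm.ofBlocks (g i) (blk i)) (BlockNorm.ofBlocks (g i) (blk i ∘ π i)) (idef (pull (π i)) (pull (π i)) (G' i) (G i))
      (fun y y' => m₀ * θ i * Real.exp (-(δ * (g i).dist y y'))))
    (hDD : ∀ i μ, HasMaj (BlockNorm.ofBlocks (g i) (blk i)) (BlockNorm.ofBlocks (g i) (blk i ∘ π i))
      (idef (pull (π i)) (pull (π i)) (D' i μ) (D i μ)) (fun y y' => m₀ * θ i * Real.exp (-(δ * (g i).dist y y'))))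
    (hT : ∀ i (U : (X' i → ℝ) × (J → X' i → ℝ)) (n : Fin 2), HasMaj (BlockNorm.ofBlocks (g i) (blk i)) (BlockNorm.ofBlocks (g i) (blk i ∘ π i))
      (T i n U) (fun y y' => B₃ * θ i * Real.exp (-(ρ₃ * (g i).dist y y')))) :
    NE2PlusOperator c35 (fun i => bgInstance₁ J (blk i) (π i) (nsh i) (hL0 i) (θc i) (θ i))
      (fun i => bgFamily₁ (blk i) (π i) (nsh i) (hL0 i) (θc i) (θ i) (ν i) (G i) (D i) (G' i) (D' i) (T i)) := by
  have hJ1 : (1 : ℝ) ≤ 1 + Fintype.card J := le_add_of_nonneg_right (Nat.cast_nonneg _)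
  have hJ0 : (0 : ℝ) < 1 + Fintype.card J := lt_of_lt_of_le one_pos hJ1
  -- the guard constant: `β·(c₃₅(1+|J|)a₀)·c_r ≤ ½`
  set a₀ : ℝ := (2 * (c35 * (1 + Fintype.card J)) * (β * cr + 1))⁻¹ with ha₀_def
  have hden : 0 < 2 * (c35 * (1 + Fintype.card J)) * (β * cr + 1) := by positivity
  have ha₀ : 0 < a₀ := inv_pos.2 hden
  have hq : β * (c35 * (1 + Fintype.card J) * a₀) * cr ≤ 1 / 2 := by
    have h1 : β * (c35 * (1 + Fintype.card J) * a₀) * cr = (β * cr) * (c35 * (1 + Fintype.card J) * a₀) := by ring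
    have h2 : c35 * (1 + Fintype.card J) * a₀ = (2 * (β * cr + 1))⁻¹ := by
      rw [ha₀_def]; field_simp
    rw [h1, h2, ← div_eq_mul_inv, div_le_iff₀ (by positivity)]
    nlinarith [mul_nonneg hβ hcr]
  have hC0 : 0 ≤ bgConst β cr m₀ (c35 * (1 + Fintype.card J)) a₀ := bgConst_nonneg hβ hcr hm₀ (mul_nonneg hc35.le hJ0.le) ha₀.le
  refine ⟨1, min (δ - σ) ρ₃, a₀, max (bgConst β cr m₀ (c35 * (1 + Fintype.card J)) a₀) B₃ + 1, γ, one_pos, lt_min (by linarith) hρ₃, ha₀,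
    lt_of_lt_of_le one_pos (le_add_of_nonneg_left (hC0.trans (le_max_left _ _))), hγ, fun i hM α₀ hα₀ hMα U hreg => ?_⟩
  have hM' : 1 ≤ (g i).M := hM
  have hMα' : (g i).M * α₀ ≤ a₀ := hMα
  have key := etaRateIneq342_background₁ (J := J) (blk i) (π i) (htri i) (hd i) hσ hcr (hrow i) (hη i) (hL i) (hlen i) hσδ.le hβ hm₀ (hθ i)
    (hθγ i) hc35 ha₀.le hq hM' hα₀ hMα' hB₃ (ν := ν i) (hG i) (hD i) (hG' i) (hD' i) (hDG i) (hDD i) hreg (hT i U)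
  intro n lam y y' hs
  refine (key n lam y y' hs).trans ?_
  have hpref : 0 ≤ B9.pref4 ((bgInstance₁ J (blk i) (π i) (nsh i) (hL0 i) (θc i) (θ i)).gc.len y) n := by
    have : 1 ≤ B9.pref4 ((opGeo (g i) (X i) (blk i)).len y) n := by rw [opGeo_len]; exact one_le_pref4 (hlen i y) n
    exact zero_le_one.trans this
  have hrf : 0 ≤ max (rateFactor (bgInstance₁ J (blk i) (π i) (nsh i) (hL0 i) (θc i) (θ i)).gc γ y)
      (rateFactor (bgInstance₁ J (blk i) (π i) (nsh i) (hL0 i) (θc i) (θ i)).gc γ y') :=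
    (T4EtaRate.rateFactor_nonneg (g := opGeo (g i) (X i) (blk i)) (hη i).le (hL i).le γ y).trans (le_max_left _ _)
  have hnorm : 0 ≤ (bgInstance₁ J (blk i) (π i) (nsh i) (hL0 i) (θc i) (θ i)).gc.supNorm lam := Real.iSup_nonneg fun x => abs_nonneg _
  have hE : 0 ≤ Real.exp (-(min (δ - σ) ρ₃ * (bgInstance₁ J (blk i) (π i) (nsh i) (hL0 i) (θc i) (θ i)).gc.dist y y')) := Real.exp_nonneg _
  exact mul_le_mul_of_nonneg_right (mul_le_mul_of_nonneg_right (mul_le_mul_of_nonneg_right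
    (mul_le_mul_of_nonneg_right (le_add_of_nonneg_right zero_le_one) hpref) hE) hrf) hnorm

end Node

end Summit.QuantumFields.YangMills.BalabanUVNodes.N15.BackgroundLayer
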